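import Literature.MathematicalPhysics.QuantumFieldTheory.Balaban1983to89.B1Eq324BenfattoKernelSect5PolyClusters
import Literature.MathematicalPhysics.QuantumFieldTheory.Balaban1983to89.B1Eq324BenfattoSect5TupleClusters
import HarnessLib

/-!
# `Balaban1983to89.B1Eq324BenfattoKernelSect5TupleClusters` — [BenfattoEtAl1978] §5 p. 158, (5.29) second term and (5.31) «(error)»
# FOR PRINT'S TUPLE-CLASS SLOTS UNDER A SHIFTED GAUSSIAN KERNEL FIELD `𝒩(0,K)∘(u + ·)⁻¹`: the UNIFORM Appendix D bound with two
# separated classes at any rate `δ ≤ δ₀` below the kernel's displayed `ℓ¹`-decay rate, and the closeness of the joint truncated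
# expectations for two kernel fields with leg-wise `ε`-close data — PROVED

statement-level skeleton of published theorems with citation tags; proofs where landed; nothing here is a claim about the
Yang–Mills mass gap

WHY THIS MODULE (cell `pub-ymgap`, seat `dag-n08-c` gen 31; node N08 [Balaban1985UV3]; the [BenfattoEtAl1978] source chain behind the
(α)-row `h324`; ROW 3 of the seat's cluster-side port map `N08-PORT-MAP-CLUSTER-SIDE.md` §1).  `…B1Eq324BenfattoSect5TupleClusters` turns
the polynomial-slot layer into statements about PRINT'S slots — the tuple-class sums `Σ_pΣ_{Δ∈T_j p}Σ_n A^n_Δ e^{−(ϰ/2)d(Δ)} Π z_{Δᵢ}^{nᵢ}` of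
(5.5)-terms (`Ψ′₁`, `Ψ″₁`, `Ψ₂`, …) — for the conditioned FREE field: (5.31)'s «(error)» with leg-wise `ε`/`R` rows on the tesserae
(`abs_ursellOf_tupleSums_condField_sub_P0_le`) and the UNIFORM Appendix D bound for two classes meeting `ℓ¹`-separated regions
(`abs_ursellOf_tupleSums_condField_le_exp_of_separated`), the latter DISCHARGING the propagator decay from the free field's (C.2)+(C.6)
(`…AppendixDWick.abs_condCov_le_exp_l1`, rate `log((2d+α²)/2d)`).  For the class road's part fields `N^K_{P,ξ} = (gaussianFieldOfKernel K_P).map (u_Γ(ξ) + ·)`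
(`…KernelSect5Eq513`) the same statements are needed for a GENERIC kernel with the decay DISPLAYED as a row: R2
`|K(x,y)| ≤ K₀·e^{−δ₀·ℓ¹(x,y)}` (at the class's per-box instance: `…ClassAppendixC.abs_inv_submatrix_apply_le_exp` / `…KernelOfPrecision` F4,
`δ₀ = κ`).  This file is that edition: the SAME re-indexing (§1 of the concrete module, BY NAME: `tupleSum_eq_sum_option`, `sum_abs_tcoef_mul_eq`,
`card_legs_le_of_mem`, `site_of_mem_legs`, `leg_mem_legs_of_mem`), the SAME geometry (`l1_site_pseudo`, `sum_sum_l1_legs_le`, `appDConst_mono`),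
over row 2 (`…KernelSect5PolyClusters`) instead of `…Sect5PolyClusters` §4–§5.

DICTIONARY.  `μ_{K,u}` ↦ `(gaussianFieldOfKernel K).map fun ζ y => u y + ζ y` (VERBATIM); rows: R0 `hK`, R1 `hdiag : ∀ y, K y y ≤ c₀`
(integrability), R2 `hdec : ∀ x y, |K x y| ≤ K₀·exp(−(δ₀·Σ_jj|x_jj − y_jj|))` (`K₀ ≥ 1`), R3 `|u(Δᵢ)| ≤ K₀` on the tesserae of all tuples of all
classes, R4 leg-wise `ε`/`R` rows as in (5.31).  The concrete module is the instance `K := condCov (freeCov d α β) Γ`, `u := condMean … z̄`,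
`K₀ := freeCov d α β` (reference), `δ₀ := log((2d+α²)/2d)`, `K₀ ≥ C₀₀`.

WHAT IS PROVED (theorems only; no definition, no named fact, no `sorry`; axioms standard).
* §1 (5.31) FOR TUPLE-CLASS SLOTS: ★ `abs_ursellOf_tupleSums_shift_sub_shift_le` (two shifted kernel fields `μ_{K₁,u₁}` vs `μ_{K₀,u₀}`),
  ★ `abs_ursellOf_tupleSums_shift_sub_kernel_le` (versus the centred `𝒩(0,K₀)` — print's `𝓔̂^T_0`, the class road's `K_ref = K_Λ`):
  `|𝓔^T_1(Y₁,…,Y_k) − 𝓔^T_0(Y₁,…,Y_k)| ≤ (Π_j 𝓜_j)·2^{kD}2^{2^{kD}}·kD·R^{kD}·ε`.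
* §2 UNIFORM APPENDIX D: ★ `abs_ursellOf_poly_shift_le_exp_of_separated` (generic polynomial slots with legs at tesserae, intra-cluster `ℓ¹`
  sums `≤ θ_c`, a separated pair of legs in every non-vanishing colouring; ANY rate `0 ≤ δ ≤ δ₀`), ★★ `abs_ursellOf_tupleSums_shift_le_exp_of_separated`
  (tuple-class slots whose classes `j₁`, `j₂` meet regions `R_A`, `R_B` at `ℓ¹`-distance `≥ ρ₀`:
  `|𝓔^T_{μ_{K,u}}(Y₁,…,Y_k)| ≤ 2^{kD}2^{2^{kD}}K₀^{kD}·e^{−(δ/2)ρ₀}·Π_j 𝓜̃_j`, `𝓜̃_j = Σ_{T_j}|A^n_Δ|e^{−(ϰ/2)d(Δ)}e^{(δ/2)D²(√d·d(Δ)+d)}`).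

HONEST SCOPE / NOT HERE.  Rows DISPLAYED, not discharged; the distributed-decay and anchored variants (`…Sect5TupleClustersDecay`,
`…Sect5TupleClustersAnchored`, rows 4–5 of the port map) are not in this file; one self-located row of an UNCOMMISSIONED port (plan g81 (II),
START-LIST v11 §n08) — nothing chained; no generalised Basic Lemma is stated; nothing of [Balaban1985UV3] is asserted; count-neutral for
N08; nothing about d = 4, the continuum, OS axioms, a mass gap or the Clay problem.
-/

open Finset MeasureTheory
open scoped BigOperators NNReal

namespace Literature.MathematicalPhysics.QuantumFieldTheory.Balaban1983to89.B1Eq324BenfattoKernelSect5TupleClusters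

open _root_.MeasureTheory _root_.ProbabilityTheory
open Literature.Probability.LatticeModels (ursellOf)
open Literature.MathematicalPhysics.QuantumFieldTheory
open Literature.MathematicalPhysics.QuantumFieldTheory.Balaban1983to89.B1Eq324BenfattoLemma
open Literature.MathematicalPhysics.QuantumFieldTheory.Balaban1983to89.B1Eq324BenfattoConnLength (connLength_nonneg)
open Literature.MathematicalPhysics.QuantumFieldTheory.Balaban1983to89.B1Eq324BenfattoSect5Eq511 (term)
open Literature.MathematicalPhysics.QuantumFieldTheory.Balaban1983to89.B1Eq324BenfattoSect5PolyClusters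
  (ursellOf_poly_eq_sum_colourings measurable_monomial)
open Literature.MathematicalPhysics.QuantumFieldTheory.Balaban1983to89.B1Eq324BenfattoSect5TupleClusters
  (tupleSum_eq_sum_option sum_abs_tcoef_mul_eq card_legs_le_of_mem site_of_mem_legs leg_mem_legs_of_mem l1_site_pseudo
   sum_sum_l1_legs_le appDConst_mono)
open Literature.MathematicalPhysics.QuantumFieldTheory.Balaban1983to89.B1Eq324BenfattoKernelSect5PolyClusters
  (integrable_abs_monomial_pow_shift abs_ursellOf_monomials_shift_le_exp abs_ursellOf_poly_shift_sub_shift_le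
   abs_ursellOf_poly_shift_sub_kernel_le)

variable {d : ℕ} {K K₁ K₀ : B1Eq324BenfattoLemma.Site d → B1Eq324BenfattoLemma.Site d → ℝ} {s D : ℕ} {ϰ : ℝ} {a : Coef d}
  {Jr : Finset (B1Eq324BenfattoLemma.Site d)}
variable {σ : Type} [Fintype σ] [DecidableEq σ] [Nonempty σ]

/-! ## §1  (5.31) «(error)» for tuple-class slots under shifted kernel fields -/

section CondFree

/-- **(5.31) FOR TUPLE-CLASS SLOTS, TWO SHIFTED KERNEL FIELDS**: for slots `Y_j = Σ_pΣ_{Δ∈T_j p}Σ_n A^n_Δ e^{−(ϰ/2)d(Δ)} Π z_{Δᵢ}^{nᵢ}` under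
`μ_{K₁,u₁}` and `μ_{K₀,u₀}` (rows R0, R1 for integrability), if on the tesserae of every tuple of every class `|u₁ − u₀| ≤ ε`, `|K₁ − K₀| ≤ ε` and
`|u₁|, |u₀|, |K₁|, |K₀| ≤ R` (`R ≥ 1`, `ε ≥ 0`), then
`|𝓔^T_{μ_{K₁,u₁}}(Y₁,…,Y_k) − 𝓔^T_{μ_{K₀,u₀}}(Y₁,…,Y_k)| ≤ (Π_j 𝓜_j)·2^{kD}2^{2^{kD}}·kD·R^{kD}·ε`, `𝓜_j = Σ_{T_j}|A^n_Δ|e^{−(ϰ/2)d(Δ)}`, `k = |σ|`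
(`…KernelSect5PolyClusters.abs_ursellOf_poly_shift_sub_shift_le` on the re-indexing of `…Sect5TupleClusters` §1).
[cite: BenfattoEtAl1978, (5.31) p.158 and p.153] -/
theorem abs_ursellOf_tupleSums_shift_sub_shift_le (hK₁ : IsPosSemidefKernel K₁) (hK₀ : IsPosSemidefKernel K₀)
    (u₁ u₀ : B1Eq324BenfattoLemma.Site d → ℝ) {c₁ c₀ : ℝ≥0} (hdiag₁ : ∀ y, K₁ y y ≤ c₁) (hdiag₀ : ∀ y, K₀ y y ≤ c₀)
    (T : σ → (p : ℕ) → Finset (Fin p → Jr)) {R ε : ℝ} (hR : 1 ≤ R) (hε : 0 ≤ ε)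
    (hu₁R : ∀ j, ∀ p ∈ Finset.Icc 1 s, ∀ Δ ∈ T j p, ∀ i, |u₁ (Δ i : B1Eq324BenfattoLemma.Site d)| ≤ R)
    (hu₀R : ∀ j, ∀ p ∈ Finset.Icc 1 s, ∀ Δ ∈ T j p, ∀ i, |u₀ (Δ i : B1Eq324BenfattoLemma.Site d)| ≤ R)
    (hK₁R : ∀ j j', ∀ p ∈ Finset.Icc 1 s, ∀ p' ∈ Finset.Icc 1 s, ∀ Δ ∈ T j p, ∀ Δ' ∈ T j' p', ∀ i i',
      |K₁ (Δ i : B1Eq324BenfattoLemma.Site d) (Δ' i' : B1Eq324BenfattoLemma.Site d)| ≤ R)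
    (hK₀R : ∀ j j', ∀ p ∈ Finset.Icc 1 s, ∀ p' ∈ Finset.Icc 1 s, ∀ Δ ∈ T j p, ∀ Δ' ∈ T j' p', ∀ i i',
      |K₀ (Δ i : B1Eq324BenfattoLemma.Site d) (Δ' i' : B1Eq324BenfattoLemma.Site d)| ≤ R)
    (huε : ∀ j, ∀ p ∈ Finset.Icc 1 s, ∀ Δ ∈ T j p, ∀ i,
      |u₁ (Δ i : B1Eq324BenfattoLemma.Site d) - u₀ (Δ i : B1Eq324BenfattoLemma.Site d)| ≤ ε)
    (hKε : ∀ j j', ∀ p ∈ Finset.Icc 1 s, ∀ p' ∈ Finset.Icc 1 s, ∀ Δ ∈ T j p, ∀ Δ' ∈ T j' p', ∀ i i',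
      |K₁ (Δ i : B1Eq324BenfattoLemma.Site d) (Δ' i' : B1Eq324BenfattoLemma.Site d) -
        K₀ (Δ i : B1Eq324BenfattoLemma.Site d) (Δ' i' : B1Eq324BenfattoLemma.Site d)| ≤ ε) :
    |ursellOf (fun P : Finset σ => ∫ z, ∏ j ∈ P,
          (∑ p ∈ Finset.Icc 1 s, ∑ Δ ∈ T j p, ∑ n ∈ admissible p D, term ϰ a z p Δ n)
            ∂((gaussianFieldOfKernel K₁).map
              fun (ζ : B1Eq324BenfattoLemma.Site d → ℝ) (y : B1Eq324BenfattoLemma.Site d) => u₁ y + ζ y)) Finset.univ -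
        ursellOf (fun P : Finset σ => ∫ z, ∏ j ∈ P,
          (∑ p ∈ Finset.Icc 1 s, ∑ Δ ∈ T j p, ∑ n ∈ admissible p D, term ϰ a z p Δ n)
            ∂((gaussianFieldOfKernel K₀).map
              fun (ζ : B1Eq324BenfattoLemma.Site d → ℝ) (y : B1Eq324BenfattoLemma.Site d) => u₀ y + ζ y)) Finset.univ| ≤
      (∏ j, ∑ p ∈ Finset.Icc 1 s, ∑ Δ ∈ T j p, ∑ n ∈ admissible p D,
          |a p (fun i => (Δ i : B1Eq324BenfattoLemma.Site d)) n| *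
            Real.exp (-(ϰ / 2) * connLength fun i => (Δ i : B1Eq324BenfattoLemma.Site d))) *
        (2 ^ (Fintype.card σ * D) * 2 ^ 2 ^ (Fintype.card σ * D) *
          ((Fintype.card σ * D : ℕ) * R ^ (Fintype.card σ * D) * ε)) := by
  classical
  simp_rw [tupleSum_eq_sum_option T]
  have hmem : ∀ c : ↥((Finset.Icc 1 s).sigma fun p =>
      (Finset.univ.filter fun Δ : Fin p → Jr => ∃ j', Δ ∈ T j' p) ×ˢ admissible p D),
      c.1.1 ∈ Finset.Icc 1 s ∧ (∃ j', c.1.2.1 ∈ T j' c.1.1) ∧ c.1.2.2 ∈ admissible c.1.1 D := by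
    intro c
    have h := Finset.mem_sigma.1 c.2
    have h2 := Finset.mem_product.1 h.2
    exact ⟨h.1, (Finset.mem_filter.1 h2.1).2, h2.2⟩
  refine (abs_ursellOf_poly_shift_sub_shift_le hK₁ hK₀ u₁ u₀ hdiag₁ hdiag₀ _ _ _ (q := D) ?_ hR hε ?_ ?_ ?_ ?_ ?_ ?_).trans
    (le_of_eq ?_)
  · rintro j (_ | c)
    · simp only [Option.elim_none, Finset.card_empty]; exact Nat.zero_le _
    · simp only [Option.elim_some]; exact card_legs_le_of_mem (hmem c).2.2
  · rintro j (_ | c) l hl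
    · simp only [Option.elim_none, Finset.notMem_empty] at hl
    · simp only [Option.elim_some] at hl ⊢
      obtain ⟨i, hi⟩ := site_of_mem_legs (Jr := Jr) (Δ := c.1.2.1) hl
      obtain ⟨hp, ⟨j', hj'⟩, hn⟩ := hmem c
      rw [hi]; exact hu₁R j' _ hp _ hj' i
  · rintro j (_ | c) l hl
    · simp only [Option.elim_none, Finset.notMem_empty] at hl
    · simp only [Option.elim_some] at hl ⊢
      obtain ⟨i, hi⟩ := site_of_mem_legs (Jr := Jr) (Δ := c.1.2.1) hl
      obtain ⟨hp, ⟨j', hj'⟩, hn⟩ := hmem c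
      rw [hi]; exact hu₀R j' _ hp _ hj' i
  · rintro j (_ | c) j₂ (_ | c') l hl l' hl'
    · simp only [Option.elim_none, Finset.notMem_empty] at hl
    · simp only [Option.elim_none, Finset.notMem_empty] at hl
    · simp only [Option.elim_none, Finset.notMem_empty] at hl'
    · simp only [Option.elim_some] at hl hl' ⊢
      obtain ⟨i, hi⟩ := site_of_mem_legs (Jr := Jr) (Δ := c.1.2.1) hl
      obtain ⟨i', hi'⟩ := site_of_mem_legs (Jr := Jr) (Δ := c'.1.2.1) hl'
      obtain ⟨hp, ⟨j', hj'⟩, -⟩ := hmem c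
      obtain ⟨hp', ⟨j'', hj''⟩, -⟩ := hmem c'
      rw [hi, hi']; exact hK₁R j' j'' _ hp _ hp' _ hj' _ hj'' i i'
  · rintro j (_ | c) j₂ (_ | c') l hl l' hl'
    · simp only [Option.elim_none, Finset.notMem_empty] at hl
    · simp only [Option.elim_none, Finset.notMem_empty] at hl
    · simp only [Option.elim_none, Finset.notMem_empty] at hl'
    · simp only [Option.elim_some] at hl hl' ⊢
      obtain ⟨i, hi⟩ := site_of_mem_legs (Jr := Jr) (Δ := c.1.2.1) hl
      obtain ⟨i', hi'⟩ := site_of_mem_legs (Jr := Jr) (Δ := c'.1.2.1) hl'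
      obtain ⟨hp, ⟨j', hj'⟩, -⟩ := hmem c
      obtain ⟨hp', ⟨j'', hj''⟩, -⟩ := hmem c'
      rw [hi, hi']; exact hK₀R j' j'' _ hp _ hp' _ hj' _ hj'' i i'
  · rintro j (_ | c) l hl
    · simp only [Option.elim_none, Finset.notMem_empty] at hl
    · simp only [Option.elim_some] at hl ⊢
      obtain ⟨i, hi⟩ := site_of_mem_legs (Jr := Jr) (Δ := c.1.2.1) hl
      obtain ⟨hp, ⟨j', hj'⟩, hn⟩ := hmem c
      rw [hi]; exact huε j' _ hp _ hj' i
  · rintro j (_ | c) j₂ (_ | c') l hl l' hl'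
    · simp only [Option.elim_none, Finset.notMem_empty] at hl
    · simp only [Option.elim_none, Finset.notMem_empty] at hl
    · simp only [Option.elim_none, Finset.notMem_empty] at hl'
    · simp only [Option.elim_some] at hl hl' ⊢
      obtain ⟨i, hi⟩ := site_of_mem_legs (Jr := Jr) (Δ := c.1.2.1) hl
      obtain ⟨i', hi'⟩ := site_of_mem_legs (Jr := Jr) (Δ := c'.1.2.1) hl'
      obtain ⟨hp, ⟨j', hj'⟩, -⟩ := hmem c
      obtain ⟨hp', ⟨j'', hj''⟩, -⟩ := hmem c'
      rw [hi, hi']; exact hKε j' j'' _ hp _ hp' _ hj' _ hj'' i i'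
  · congr 1
    refine Finset.prod_congr rfl fun j _ => ?_
    rw [Fintype.sum_option]
    simp only [Option.elim_none, Option.elim_some, abs_zero, zero_add]
    have h := sum_abs_tcoef_mul_eq (s := s) (D := D) (ϰ := ϰ) (a := a) T j (fun _ => (1 : ℝ))
    simp only [mul_one] at h
    exact h

/-- **(5.31) FOR TUPLE-CLASS SLOTS, SHIFTED versus CENTRED KERNEL FIELD** (print's reference `𝓔̂^T_0`; the class road's `K_ref = K_Λ`): the same
with `μ_{K₀,u₀}` replaced by the centred `𝒩(0,K₀)` and the rows `|u₁| ≤ ε`, `|u₁|, |K₁|, |K₀| ≤ R`, `|K₁ − K₀| ≤ ε` on the tesserae.  The concrete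
`…Sect5TupleClusters.abs_ursellOf_tupleSums_condField_sub_P0_le` is the instance `K₁ := condCov (freeCov …) Γ`, `u₁ := condMean … z̄`,
`K₀ := freeCov d α β`. [cite: BenfattoEtAl1978, (5.31) p.158 and p.153] -/
theorem abs_ursellOf_tupleSums_shift_sub_kernel_le (hK₁ : IsPosSemidefKernel K₁) (hK₀ : IsPosSemidefKernel K₀)
    (u₁ : B1Eq324BenfattoLemma.Site d → ℝ) {c₁ c₀ : ℝ≥0} (hdiag₁ : ∀ y, K₁ y y ≤ c₁) (hdiag₀ : ∀ y, K₀ y y ≤ c₀)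
    (T : σ → (p : ℕ) → Finset (Fin p → Jr)) {R ε : ℝ} (hR : 1 ≤ R) (hε : 0 ≤ ε)
    (hu₁R : ∀ j, ∀ p ∈ Finset.Icc 1 s, ∀ Δ ∈ T j p, ∀ i, |u₁ (Δ i : B1Eq324BenfattoLemma.Site d)| ≤ R)
    (hK₁R : ∀ j j', ∀ p ∈ Finset.Icc 1 s, ∀ p' ∈ Finset.Icc 1 s, ∀ Δ ∈ T j p, ∀ Δ' ∈ T j' p', ∀ i i',
      |K₁ (Δ i : B1Eq324BenfattoLemma.Site d) (Δ' i' : B1Eq324BenfattoLemma.Site d)| ≤ R)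
    (hK₀R : ∀ j j', ∀ p ∈ Finset.Icc 1 s, ∀ p' ∈ Finset.Icc 1 s, ∀ Δ ∈ T j p, ∀ Δ' ∈ T j' p', ∀ i i',
      |K₀ (Δ i : B1Eq324BenfattoLemma.Site d) (Δ' i' : B1Eq324BenfattoLemma.Site d)| ≤ R)
    (huε : ∀ j, ∀ p ∈ Finset.Icc 1 s, ∀ Δ ∈ T j p, ∀ i, |u₁ (Δ i : B1Eq324BenfattoLemma.Site d)| ≤ ε)
    (hKε : ∀ j j', ∀ p ∈ Finset.Icc 1 s, ∀ p' ∈ Finset.Icc 1 s, ∀ Δ ∈ T j p, ∀ Δ' ∈ T j' p', ∀ i i',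
      |K₁ (Δ i : B1Eq324BenfattoLemma.Site d) (Δ' i' : B1Eq324BenfattoLemma.Site d) -
        K₀ (Δ i : B1Eq324BenfattoLemma.Site d) (Δ' i' : B1Eq324BenfattoLemma.Site d)| ≤ ε) :
    |ursellOf (fun P : Finset σ => ∫ z, ∏ j ∈ P,
          (∑ p ∈ Finset.Icc 1 s, ∑ Δ ∈ T j p, ∑ n ∈ admissible p D, term ϰ a z p Δ n)
            ∂((gaussianFieldOfKernel K₁).map
              fun (ζ : B1Eq324BenfattoLemma.Site d → ℝ) (y : B1Eq324BenfattoLemma.Site d) => u₁ y + ζ y)) Finset.univ -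
        ursellOf (fun P : Finset σ => ∫ z, ∏ j ∈ P,
          (∑ p ∈ Finset.Icc 1 s, ∑ Δ ∈ T j p, ∑ n ∈ admissible p D, term ϰ a z p Δ n)
            ∂(gaussianFieldOfKernel K₀)) Finset.univ| ≤
      (∏ j, ∑ p ∈ Finset.Icc 1 s, ∑ Δ ∈ T j p, ∑ n ∈ admissible p D,
          |a p (fun i => (Δ i : B1Eq324BenfattoLemma.Site d)) n| *
            Real.exp (-(ϰ / 2) * connLength fun i => (Δ i : B1Eq324BenfattoLemma.Site d))) *
        (2 ^ (Fintype.card σ * D) * 2 ^ 2 ^ (Fintype.card σ * D) *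
          ((Fintype.card σ * D : ℕ) * R ^ (Fintype.card σ * D) * ε)) := by
  classical
  simp_rw [tupleSum_eq_sum_option T]
  have hmem : ∀ c : ↥((Finset.Icc 1 s).sigma fun p =>
      (Finset.univ.filter fun Δ : Fin p → Jr => ∃ j', Δ ∈ T j' p) ×ˢ admissible p D),
      c.1.1 ∈ Finset.Icc 1 s ∧ (∃ j', c.1.2.1 ∈ T j' c.1.1) ∧ c.1.2.2 ∈ admissible c.1.1 D := by
    intro c
    have h := Finset.mem_sigma.1 c.2
    have h2 := Finset.mem_product.1 h.2
    exact ⟨h.1, (Finset.mem_filter.1 h2.1).2, h2.2⟩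
  refine (abs_ursellOf_poly_shift_sub_kernel_le hK₁ hK₀ u₁ hdiag₁ hdiag₀ _ _ _ (q := D) ?_ hR hε ?_ ?_ ?_ ?_ ?_).trans
    (le_of_eq ?_)
  · rintro j (_ | c)
    · simp only [Option.elim_none, Finset.card_empty]; exact Nat.zero_le _
    · simp only [Option.elim_some]; exact card_legs_le_of_mem (hmem c).2.2
  · rintro j (_ | c) l hl
    · simp only [Option.elim_none, Finset.notMem_empty] at hl
    · simp only [Option.elim_some] at hl ⊢
      obtain ⟨i, hi⟩ := site_of_mem_legs (Jr := Jr) (Δ := c.1.2.1) hl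
      obtain ⟨hp, ⟨j', hj'⟩, hn⟩ := hmem c
      rw [hi]; exact hu₁R j' _ hp _ hj' i
  · rintro j (_ | c) j₂ (_ | c') l hl l' hl'
    · simp only [Option.elim_none, Finset.notMem_empty] at hl
    · simp only [Option.elim_none, Finset.notMem_empty] at hl
    · simp only [Option.elim_none, Finset.notMem_empty] at hl'
    · simp only [Option.elim_some] at hl hl' ⊢
      obtain ⟨i, hi⟩ := site_of_mem_legs (Jr := Jr) (Δ := c.1.2.1) hl
      obtain ⟨i', hi'⟩ := site_of_mem_legs (Jr := Jr) (Δ := c'.1.2.1) hl'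
      obtain ⟨hp, ⟨j', hj'⟩, -⟩ := hmem c
      obtain ⟨hp', ⟨j'', hj''⟩, -⟩ := hmem c'
      rw [hi, hi']; exact hK₁R j' j'' _ hp _ hp' _ hj' _ hj'' i i'
  · rintro j (_ | c) j₂ (_ | c') l hl l' hl'
    · simp only [Option.elim_none, Finset.notMem_empty] at hl
    · simp only [Option.elim_none, Finset.notMem_empty] at hl
    · simp only [Option.elim_none, Finset.notMem_empty] at hl'
    · simp only [Option.elim_some] at hl hl' ⊢
      obtain ⟨i, hi⟩ := site_of_mem_legs (Jr := Jr) (Δ := c.1.2.1) hl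
      obtain ⟨i', hi'⟩ := site_of_mem_legs (Jr := Jr) (Δ := c'.1.2.1) hl'
      obtain ⟨hp, ⟨j', hj'⟩, -⟩ := hmem c
      obtain ⟨hp', ⟨j'', hj''⟩, -⟩ := hmem c'
      rw [hi, hi']; exact hK₀R j' j'' _ hp _ hp' _ hj' _ hj'' i i'
  · rintro j (_ | c) l hl
    · simp only [Option.elim_none, Finset.notMem_empty] at hl
    · simp only [Option.elim_some] at hl ⊢
      obtain ⟨i, hi⟩ := site_of_mem_legs (Jr := Jr) (Δ := c.1.2.1) hl
      obtain ⟨hp, ⟨j', hj'⟩, hn⟩ := hmem c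
      rw [hi]; exact huε j' _ hp _ hj' i
  · rintro j (_ | c) j₂ (_ | c') l hl l' hl'
    · simp only [Option.elim_none, Finset.notMem_empty] at hl
    · simp only [Option.elim_none, Finset.notMem_empty] at hl
    · simp only [Option.elim_none, Finset.notMem_empty] at hl'
    · simp only [Option.elim_some] at hl hl' ⊢
      obtain ⟨i, hi⟩ := site_of_mem_legs (Jr := Jr) (Δ := c.1.2.1) hl
      obtain ⟨i', hi'⟩ := site_of_mem_legs (Jr := Jr) (Δ := c'.1.2.1) hl'
      obtain ⟨hp, ⟨j', hj'⟩, -⟩ := hmem c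
      obtain ⟨hp', ⟨j'', hj''⟩, -⟩ := hmem c'
      rw [hi, hi']; exact hKε j' j'' _ hp _ hp' _ hj' _ hj'' i i'
  · congr 1
    refine Finset.prod_congr rfl fun j _ => ?_
    rw [Fintype.sum_option]
    simp only [Option.elim_none, Option.elim_some, abs_zero, zero_add]
    have h := sum_abs_tcoef_mul_eq (s := s) (D := D) (ϰ := ϰ) (a := a) T j (fun _ => (1 : ℝ))
    simp only [mul_one] at h
    exact h

end CondFree

/-! ## §2  The UNIFORM Appendix D bound for tuple-class slots with two separated classes, decay row displayed -/

section AppendixD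

/-- **UNIFORM APPENDIX D, GENERIC POLYNOMIAL SLOTS, SHIFTED KERNEL FIELD** (`Z_j = Σ_c a_{jc}·Π_{l∈J_c} z(x_{cl})` over a finite index `ι`, legs at
tesserae, `ℓ¹` pseudo-distance): under `μ_{K,u}` with rows R0, R1 (integrability), R2 `|K(x,y)| ≤ K₀e^{−δ₀ℓ¹(x,y)}` and R3 `|u| ≤ K₀` on the legs
(`K₀ ≥ 1`), if every index has `≤ D` legs and intra-cluster `ℓ¹` sum `≤ θ_c`, and every colouring `f` with all coefficients `a_{j f(j)} ≠ 0` has a leg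
of `f(j₁)` and a leg of `f(j₂)` at `ℓ¹` distance `≥ ρ₀`, then for ANY rate `0 ≤ δ ≤ δ₀`
`|𝓔^T_{μ_{K,u}}(Z₁,…,Z_k)| ≤ 2^{kD}·2^{2^{kD}}·K₀^{kD}·e^{−(δ/2)ρ₀}·Π_j Σ_c |a_{jc}|·e^{(δ/2)θ_c}` — colouring by colouring through
`…KernelSect5PolyClusters.abs_ursellOf_monomials_shift_le_exp`.  The concrete `…Sect5TupleClusters.abs_ursellOf_poly_condField_le_exp_of_separated`
is the instance `K := condCov (freeCov …) Γ`, `δ₀ := log((2d+α²)/2d)` (`…AppendixDWick.abs_condCov_le_exp_l1`).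
[cite: BenfattoEtAl1978, (5.29) p.158 and Appendix D p.166] -/
theorem abs_ursellOf_poly_shift_le_exp_of_separated {ι : Type*} [Fintype ι] [Nonempty ι] {κ : Type}
    (hK : IsPosSemidefKernel K) (u : B1Eq324BenfattoLemma.Site d → ℝ) {c₀ : ℝ≥0} (hdiag : ∀ y, K y y ≤ c₀)
    (ac : σ → ι → ℝ) (Jm : ι → Finset κ) (xs : ι → κ → B1Eq324BenfattoLemma.Site d) {K₀ δ₀ : ℝ} (hK₀ : 1 ≤ K₀)
    (hdec : ∀ x y : B1Eq324BenfattoLemma.Site d, |K x y| ≤ K₀ * Real.exp (-(δ₀ * ∑ jj, |((x jj : ℝ) - (y jj : ℝ))|)))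
    (hu : ∀ c, ∀ l ∈ Jm c, |u (xs c l)| ≤ K₀)
    (hq : ∀ c, (Jm c).card ≤ D) (θ : ι → ℝ)
    (hθ : ∀ c, ∑ l ∈ Jm c, ∑ l' ∈ Jm c, ∑ jj, |((xs c l jj : ℝ) - (xs c l' jj : ℝ))| ≤ θ c)
    {δ : ℝ} (hδ : 0 ≤ δ) (hδle : δ ≤ δ₀)
    (j₁ j₂ : σ) {ρ₀ : ℝ}
    (hsep : ∀ f : σ → ι, (∀ j, ac j (f j) ≠ 0) →
      ∃ l₁ ∈ Jm (f j₁), ∃ l₂ ∈ Jm (f j₂), ρ₀ ≤ ∑ jj, |((xs (f j₁) l₁ jj : ℝ) - (xs (f j₂) l₂ jj : ℝ))|) :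
    |ursellOf (fun P : Finset σ => ∫ z, ∏ j ∈ P, (∑ c, ac j c * ∏ l ∈ Jm c, z (xs c l))
        ∂((gaussianFieldOfKernel K).map
          fun (ζ : B1Eq324BenfattoLemma.Site d → ℝ) (y : B1Eq324BenfattoLemma.Site d) => u y + ζ y)) Finset.univ| ≤
      2 ^ (Fintype.card σ * D) * 2 ^ 2 ^ (Fintype.card σ * D) * K₀ ^ (Fintype.card σ * D) *
        Real.exp (-(δ / 2 * ρ₀)) * ∏ j, ∑ c, |ac j c| * Real.exp (δ / 2 * θ c) := by
  haveI := isProbabilityMeasure_gaussianFieldOfKernel hK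
  have hTm : Measurable (fun (ζ : B1Eq324BenfattoLemma.Site d → ℝ) (y : B1Eq324BenfattoLemma.Site d) => u y + ζ y) :=
    measurable_pi_lambda _ fun y => measurable_const.add (measurable_pi_apply y)
  haveI : IsProbabilityMeasure ((gaussianFieldOfKernel K).map
      fun (ζ : B1Eq324BenfattoLemma.Site d → ℝ) (y : B1Eq324BenfattoLemma.Site d) => u y + ζ y) :=
    Measure.isProbabilityMeasure_map hTm.aemeasurable
  obtain ⟨h0, hsymm, htri, hnn⟩ := l1_site_pseudo (d := d)
  -- the propagator decay at the weaker rate `δ ≤ δ₀`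
  have hCov : ∀ x y : B1Eq324BenfattoLemma.Site d, |K x y| ≤
      K₀ * Real.exp (-(δ * ∑ jj, |((x jj : ℝ) - (y jj : ℝ))|)) := by
    intro x y
    refine (hdec x y).trans (mul_le_mul_of_nonneg_left (Real.exp_le_exp.2 ?_) (zero_le_one.trans hK₀))
    have := hnn x y
    nlinarith
  have hm : ∀ (j : σ) (c : ι), AEStronglyMeasurable (fun z : B1Eq324BenfattoLemma.Site d → ℝ => ∏ l ∈ Jm c, z (xs c l))
      ((gaussianFieldOfKernel K).map
        fun (ζ : B1Eq324BenfattoLemma.Site d → ℝ) (y : B1Eq324BenfattoLemma.Site d) => u y + ζ y) :=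
    fun j c => (measurable_monomial (Jm c) (xs c)).aestronglyMeasurable
  have hint : ∀ (j : σ) (c : ι) (q : ℕ), q ≤ Fintype.card σ →
      Integrable (fun z : B1Eq324BenfattoLemma.Site d → ℝ => |∏ l ∈ Jm c, z (xs c l)| ^ q)
        ((gaussianFieldOfKernel K).map
          fun (ζ : B1Eq324BenfattoLemma.Site d → ℝ) (y : B1Eq324BenfattoLemma.Site d) => u y + ζ y) :=
    fun j c q _ => integrable_abs_monomial_pow_shift hK u hdiag (Jm c) (xs c) q
  rw [ursellOf_poly_eq_sum_colourings
    (μ := (gaussianFieldOfKernel K).map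
      fun (ζ : B1Eq324BenfattoLemma.Site d → ℝ) (y : B1Eq324BenfattoLemma.Site d) => u y + ζ y) ac
    (fun (_ : σ) (c : ι) (z : B1Eq324BenfattoLemma.Site d → ℝ) => ∏ l ∈ Jm c, z (xs c l)) hm hint]
  set C := (2 : ℝ) ^ (Fintype.card σ * D) * 2 ^ 2 ^ (Fintype.card σ * D) * K₀ ^ (Fintype.card σ * D) with hC
  have hC0 : 0 ≤ C := by positivity
  -- per colouring
  have hf : ∀ f : σ → ι,
      |(∏ j, ac j (f j)) * ursellOf (fun P : Finset σ => ∫ z, ∏ j ∈ P, ∏ l ∈ Jm (f j), z (xs (f j) l)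
        ∂((gaussianFieldOfKernel K).map
          fun (ζ : B1Eq324BenfattoLemma.Site d → ℝ) (y : B1Eq324BenfattoLemma.Site d) => u y + ζ y)) Finset.univ| ≤
        C * Real.exp (-(δ / 2 * ρ₀)) * ∏ j, (|ac j (f j)| * Real.exp (δ / 2 * θ (f j))) := by
    intro f
    by_cases hgood : ∀ j, ac j (f j) ≠ 0
    · obtain ⟨l₁, hl₁, l₂, hl₂, hρ₀⟩ := hsep f hgood
      have hAD := abs_ursellOf_monomials_shift_le_exp hK u (fun j => Jm (f j)) (fun j => xs (f j))
        (fun x y : B1Eq324BenfattoLemma.Site d => ∑ jj, |((x jj : ℝ) - (y jj : ℝ))|) h0 hsymm htri hnn hK₀ hδ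
        (fun j l hl => hu (f j) l hl) (fun j j' l _ l' _ => hCov (xs (f j) l) (xs (f j') l')) hl₁ hl₂
      have hN : ∑ j, (Jm (f j)).card ≤ Fintype.card σ * D := by
        calc ∑ j, (Jm (f j)).card ≤ ∑ _j : σ, D := Finset.sum_le_sum fun j _ => hq (f j)
          _ = Fintype.card σ * D := by rw [Finset.sum_const, smul_eq_mul, Finset.card_univ]
      have hI : ∑ j, ∑ l ∈ Jm (f j), ∑ l' ∈ Jm (f j), (∑ jj, |((xs (f j) l jj : ℝ) - (xs (f j) l' jj : ℝ))|) ≤ ∑ j, θ (f j) :=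
        Finset.sum_le_sum fun j _ => hθ (f j)
      have hexp : Real.exp (-(δ / 2 * ((∑ jj, |((xs (f j₁) l₁ jj : ℝ) - (xs (f j₂) l₂ jj : ℝ))|) -
          ∑ j, ∑ l ∈ Jm (f j), ∑ l' ∈ Jm (f j), ∑ jj, |((xs (f j) l jj : ℝ) - (xs (f j) l' jj : ℝ))|))) ≤
          Real.exp (-(δ / 2 * ρ₀)) * ∏ j, Real.exp (δ / 2 * θ (f j)) := by
        rw [← Real.exp_sum, ← Real.exp_add, Real.exp_le_exp, ← Finset.mul_sum]
        nlinarith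
      rw [abs_mul, Finset.abs_prod]
      calc (∏ j, |ac j (f j)|) * |ursellOf (fun P : Finset σ => ∫ z, ∏ j ∈ P, ∏ l ∈ Jm (f j), z (xs (f j) l)
              ∂((gaussianFieldOfKernel K).map
                fun (ζ : B1Eq324BenfattoLemma.Site d → ℝ) (y : B1Eq324BenfattoLemma.Site d) => u y + ζ y)) Finset.univ|
          ≤ (∏ j, |ac j (f j)|) * (C * (Real.exp (-(δ / 2 * ρ₀)) * ∏ j, Real.exp (δ / 2 * θ (f j)))) := by
            refine mul_le_mul_of_nonneg_left (hAD.trans ?_) (Finset.prod_nonneg fun j _ => abs_nonneg _)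
            calc (2 : ℝ) ^ (∑ j, (Jm (f j)).card) * 2 ^ 2 ^ (∑ j, (Jm (f j)).card) * (K₀ ^ (∑ j, (Jm (f j)).card) *
                  Real.exp (-(δ / 2 * ((∑ jj, |((xs (f j₁) l₁ jj : ℝ) - (xs (f j₂) l₂ jj : ℝ))|) -
                    ∑ j, ∑ l ∈ Jm (f j), ∑ l' ∈ Jm (f j), ∑ jj, |((xs (f j) l jj : ℝ) - (xs (f j) l' jj : ℝ))|))))
                = (2 : ℝ) ^ (∑ j, (Jm (f j)).card) * 2 ^ 2 ^ (∑ j, (Jm (f j)).card) * K₀ ^ (∑ j, (Jm (f j)).card) *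
                  Real.exp (-(δ / 2 * ((∑ jj, |((xs (f j₁) l₁ jj : ℝ) - (xs (f j₂) l₂ jj : ℝ))|) -
                    ∑ j, ∑ l ∈ Jm (f j), ∑ l' ∈ Jm (f j), ∑ jj, |((xs (f j) l jj : ℝ) - (xs (f j) l' jj : ℝ))|))) := by
                  ring
              _ ≤ C * (Real.exp (-(δ / 2 * ρ₀)) * ∏ j, Real.exp (δ / 2 * θ (f j))) :=
                  mul_le_mul (appDConst_mono hK₀ hN) hexp (Real.exp_pos _).le hC0
        _ = C * Real.exp (-(δ / 2 * ρ₀)) * ∏ j, (|ac j (f j)| * Real.exp (δ / 2 * θ (f j))) := by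
            rw [Finset.prod_mul_distrib]; ring
    · obtain ⟨j, hj⟩ := not_forall.1 hgood
      have hj : ac j (f j) = 0 := not_ne_iff.1 hj
      have hprod : ∏ j, ac j (f j) = 0 := Finset.prod_eq_zero (Finset.mem_univ j) hj
      have hprod' : ∏ j, (|ac j (f j)| * Real.exp (δ / 2 * θ (f j))) = 0 :=
        Finset.prod_eq_zero (Finset.mem_univ j) (by rw [hj, abs_zero, zero_mul])
      rw [hprod, zero_mul, abs_zero, hprod', mul_zero]
  refine (Finset.abs_sum_le_sum_abs _ _).trans ((Finset.sum_le_sum fun f _ => hf f).trans (le_of_eq ?_))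
  rw [← Finset.mul_sum, ← Fintype.prod_sum fun j c => |ac j c| * Real.exp (δ / 2 * θ c)]

/-- **THE UNIFORM APPENDIX D BOUND FOR TUPLE-CLASS SLOTS WITH TWO SEPARATED CLASSES, SHIFTED KERNEL FIELD** (the `h29` / anchored-CROSS
supplier): let `Y_j = Σ_pΣ_{Δ∈T_j p}Σ_n A^n_Δ e^{−(ϰ/2)d(Δ)} Π z_{Δᵢ}^{nᵢ}` (`j ∈ σ`, `k = |σ|`) under `μ_{K,u}` with rows R0, R1, R2
`|K(x,y)| ≤ K₀e^{−δ₀ℓ¹(x,y)}` and R3 `|u| ≤ K₀` on the tesserae of all tuples of all classes (`K₀ ≥ 1`).  If every tuple of the class of slot `j₁`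
meets a region `R_A` and every tuple of the class of slot `j₂` meets `R_B`, with `ℓ¹(x, y) ≥ ρ₀` for `x ∈ R_A`, `y ∈ R_B`, then for ANY rate
`0 ≤ δ ≤ δ₀`: `|𝓔^T_{μ_{K,u}}(Y₁,…,Y_k)| ≤ 2^{kD}·2^{2^{kD}}·K₀^{kD}·e^{−(δ/2)ρ₀}·Π_j 𝓜̃_j`,
`𝓜̃_j = Σ_{T_j}|A^n_Δ|e^{−(ϰ/2)d(Δ)}·e^{(δ/2)D²(√d·d(Δ)+d)}` (`abs_ursellOf_poly_shift_le_exp_of_separated` on the re-indexing; designated legs at the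
tesserae in `R_A`, `R_B`; intra-cluster sums by `…Sect5TupleClusters.sum_sum_l1_legs_le`).  The concrete
`…Sect5TupleClusters.abs_ursellOf_tupleSums_condField_le_exp_of_separated` is the instance `K := condCov (freeCov …) Γ`, `δ₀ := log((2d+α²)/2d)`.
[cite: BenfattoEtAl1978, (5.29) p.158 and Appendix D p.166] -/
theorem abs_ursellOf_tupleSums_shift_le_exp_of_separated (hK : IsPosSemidefKernel K) (u : B1Eq324BenfattoLemma.Site d → ℝ)
    {c₀ : ℝ≥0} (hdiag : ∀ y, K y y ≤ c₀)
    (T : σ → (p : ℕ) → Finset (Fin p → Jr)) {K₀ δ₀ : ℝ} (hK₀ : 1 ≤ K₀)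
    (hdec : ∀ x y : B1Eq324BenfattoLemma.Site d, |K x y| ≤ K₀ * Real.exp (-(δ₀ * ∑ jj, |((x jj : ℝ) - (y jj : ℝ))|)))
    (hu : ∀ j, ∀ p ∈ Finset.Icc 1 s, ∀ Δ ∈ T j p, ∀ i, |u (Δ i : B1Eq324BenfattoLemma.Site d)| ≤ K₀)
    {δ : ℝ} (hδ : 0 ≤ δ) (hδle : δ ≤ δ₀)
    (j₁ j₂ : σ) (RA RB : Set (B1Eq324BenfattoLemma.Site d)) {ρ₀ : ℝ}
    (hA : ∀ p ∈ Finset.Icc 1 s, ∀ Δ ∈ T j₁ p, ∃ i, (Δ i : B1Eq324BenfattoLemma.Site d) ∈ RA)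
    (hB : ∀ p ∈ Finset.Icc 1 s, ∀ Δ ∈ T j₂ p, ∃ i, (Δ i : B1Eq324BenfattoLemma.Site d) ∈ RB)
    (hρ : ∀ x ∈ RA, ∀ y ∈ RB, ρ₀ ≤ ∑ j, |((x j : ℝ) - (y j : ℝ))|) :
    |ursellOf (fun P : Finset σ => ∫ z, ∏ j ∈ P,
        (∑ p ∈ Finset.Icc 1 s, ∑ Δ ∈ T j p, ∑ n ∈ admissible p D, term ϰ a z p Δ n)
          ∂((gaussianFieldOfKernel K).map
            fun (ζ : B1Eq324BenfattoLemma.Site d → ℝ) (y : B1Eq324BenfattoLemma.Site d) => u y + ζ y)) Finset.univ| ≤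
      2 ^ (Fintype.card σ * D) * 2 ^ 2 ^ (Fintype.card σ * D) * K₀ ^ (Fintype.card σ * D) * Real.exp (-(δ / 2 * ρ₀)) *
        ∏ j, ∑ p ∈ Finset.Icc 1 s, ∑ Δ ∈ T j p, ∑ n ∈ admissible p D,
          |a p (fun i => (Δ i : B1Eq324BenfattoLemma.Site d)) n| *
            Real.exp (-(ϰ / 2) * connLength fun i => (Δ i : B1Eq324BenfattoLemma.Site d)) *
            Real.exp (δ / 2 * ((D : ℝ) ^ 2 * (Real.sqrt d * connLength (fun i => (Δ i : B1Eq324BenfattoLemma.Site d)) + d))) := by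
  classical
  simp_rw [tupleSum_eq_sum_option T]
  have hmem : ∀ c : ↥((Finset.Icc 1 s).sigma fun p =>
      (Finset.univ.filter fun Δ : Fin p → Jr => ∃ j', Δ ∈ T j' p) ×ˢ admissible p D),
      c.1.1 ∈ Finset.Icc 1 s ∧ (∃ j', c.1.2.1 ∈ T j' c.1.1) ∧ c.1.2.2 ∈ admissible c.1.1 D := by
    intro c
    have h := Finset.mem_sigma.1 c.2
    have h2 := Finset.mem_product.1 h.2
    exact ⟨h.1, (Finset.mem_filter.1 h2.1).2, h2.2⟩
  refine (abs_ursellOf_poly_shift_le_exp_of_separated (D := D) (ρ₀ := ρ₀) hK u hdiag _ _ _ hK₀ hdec ?_ ?_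
    (fun c : Option ↥((Finset.Icc 1 s).sigma fun p =>
        (Finset.univ.filter fun Δ : Fin p → Jr => ∃ j', Δ ∈ T j' p) ×ˢ admissible p D) => c.elim 0 fun c =>
      (D : ℝ) ^ 2 * (Real.sqrt d * connLength (fun i => (c.1.2.1 i : B1Eq324BenfattoLemma.Site d)) + d)) ?_ hδ hδle j₁ j₂ ?_).trans
    (le_of_eq ?_)
  · rintro (_ | c) l hl
    · simp only [Option.elim_none, Finset.notMem_empty] at hl
    · simp only [Option.elim_some] at hl ⊢
      obtain ⟨i, hi⟩ := site_of_mem_legs (Jr := Jr) (Δ := c.1.2.1) hl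
      obtain ⟨hp, ⟨j', hj'⟩, -⟩ := hmem c
      rw [hi]; exact hu j' _ hp _ hj' i
  · rintro (_ | c)
    · simp only [Option.elim_none, Finset.card_empty]; exact Nat.zero_le _
    · simp only [Option.elim_some]; exact card_legs_le_of_mem (hmem c).2.2
  · rintro (_ | c)
    · simp only [Option.elim_none, Finset.sum_empty]; exact le_rfl
    · simp only [Option.elim_some]
      exact sum_sum_l1_legs_le (D := D) c.1.2.1 (hmem c).2.2
  · intro f hf
    -- every chosen index is a tuple of its own class
    have hcls : ∀ j, ∃ c, f j = some c ∧ c.1.2.1 ∈ T j c.1.1 := by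
      intro j
      have h := hf j
      rcases hfj : f j with _ | c
      · rw [hfj] at h; exact absurd rfl h
      · rw [hfj] at h
        simp only [Option.elim_some] at h
        by_cases hc : c.1.2.1 ∈ T j c.1.1
        · exact ⟨c, rfl, hc⟩
        · exact absurd (if_neg hc) h
    obtain ⟨c₁, hc₁, hT₁⟩ := hcls j₁
    obtain ⟨c₂, hc₂, hT₂⟩ := hcls j₂
    obtain ⟨i₁, hi₁⟩ := hA _ (hmem c₁).1 _ hT₁
    obtain ⟨i₂, hi₂⟩ := hB _ (hmem c₂).1 _ hT₂
    refine ⟨((i₁ : ℕ), 0), ?_, ((i₂ : ℕ), 0), ?_, ?_⟩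
    · rw [hc₁]; exact leg_mem_legs_of_mem (hmem c₁).2.2 i₁
    · rw [hc₂]; exact leg_mem_legs_of_mem (hmem c₂).2.2 i₂
    · rw [hc₁, hc₂]
      simp only [Option.elim_some, Fin.is_lt, dif_pos, Fin.eta]
      exact hρ _ hi₁ _ hi₂
  · congr 1
    refine Finset.prod_congr rfl fun j _ => ?_
    rw [Fintype.sum_option]
    simp only [Option.elim_none, Option.elim_some, abs_zero, zero_mul, zero_add]
    exact sum_abs_tcoef_mul_eq (s := s) (D := D) (ϰ := ϰ) (a := a) T j
      (fun c => Real.exp (δ / 2 * ((D : ℝ) ^ 2 * (Real.sqrt d * connLength (fun i => (c.2.1 i : B1Eq324BenfattoLemma.Site d)) + d))))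

end AppendixD

end Literature.MathematicalPhysics.QuantumFieldTheory.Balaban1983to89.B1Eq324BenfattoKernelSect5TupleClusters
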